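import Literature.MathematicalPhysics.QuantumLattice.HubbardGridFieldSubstitution
import Literature.MathematicalPhysics.QuantumLattice.HubbardSpaceTimeCharacters
import HarnessLib

/-!
# The grid propagators as character sums on the space–time dual torus `(ℤ/N) × (ℤ/L)²`; row and column sums

Topic `MathematicalPhysics/QuantumLattice`; the `N`-point-grid form of `HubbardSpaceTimeCharacters.lean` (there the time lattice was the
`2M`-point dual of the Matsubara frequencies).  On the grid `{jβ/N} × (ℤ/L)²` of `HubbardGridFieldSubstitution` (`N ≥ 2M`, in the cell
gate-hubbard-kl `N ≥ 4M - 1` so that the quartic vertex is exactly local) the `2M` fermionic frequencies `π(2n+1)/β` at the times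
`jβ/N` are the characters `e^{2πi·ij/N}` of `ℤ/N` — indexed by the residues `i mod N` of the Matsubara indices — times a unimodular factor
independent of the frequency; the symbol is transported to the product torus `(ℤ/N)¹ × (ℤ/L)²` by ZERO PADDING off the image of the
Matsubara indices (`gridSymbol`).  Hence the `(+,-)` propagator between two grid points is a product-torus character sum
(`gridSub_pullback_apply_zero_one_eq_charSum`), and every row and every column sum of the pulled-back covariance `Sᵀ C S` over the grid
legs is at most `A = max_σ Σ_{(a,b)} ‖Σ_q χ_q(a,b) G_σ(q)‖` (`sum_norm_gridSub_pullback_row_le`, `sum_norm_gridSub_pullback_col_le`) —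
the shape `Σ_{a,b} ‖Σ_{p,p'} χ_p(a) χ_{p'}(b) G(p,p')‖` priced by the weighted Plancherel inequality
`TorusFourierWeightedL1Prod.sum_sum_norm_prodChar_le` (Benfatto–Giuliani–Mastropietro 2006, §2.1 and footnote ¹, Lemma 2.2 at finite
`(β, L)`: the `L¹` norms `α_j` of the single-scale propagators; cell gate-hubbard-kl, R0-SCOPE-4 W2a).

* `gridSymbol` — the zero-padded symbol `G_σ(q₀, q⃗) = (βL²)⁻² p((n(q₀), q⃗), σ)` (`0` if `q₀ ∉ [0, 2M)`);
* `sum_freqMomentum_eq_sum_gridTorus` — momentum sums as product-torus sums of the padded function;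
* `exp_matsubara_gridPhase_eq` — `e^{iω_i(τ_j - τ_{j'})} = χ_{(i mod N)}(j - j') · e^{iπ(1-2M)(j-j')/N}`;
* **`gridSub_pullback_apply_zero_one_eq_charSum`**, `norm_gridSub_pullback_apply_zero_one_eq`;
* **`sum_norm_gridSub_pullback_row_le`**, **`sum_norm_gridSub_pullback_col_le`**.

Everything is proved; the padded symbol is the only definition; no named facts.

## Sources

G. Benfatto, A. Giuliani, V. Mastropietro, Ann. Henri Poincaré 7 (2006) 809–898, §2.1 (2.2)–(2.5), Lemma 2.2 and footnote ¹
(`BenfattoGiulianiMastropietro2006`); M. Salmhofer, *Renormalization* (1999), §4.2.4 (4.55)–(4.63) (`Salmhofer1999`).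
-/

noncomputable section

namespace Literature.MathematicalPhysics.QuantumLattice

open Finset Complex Literature.Probability.LatticeModels GrassmannAlgebra
open scoped Real ComplexConjugate

variable {L M N : ℕ}

/-! ### The Matsubara indices inside the time dual torus `ℤ/N` (`2M ≤ N`) -/

/-- `val (i mod N) = i` for a Matsubara index `i < 2M ≤ N` (the Matsubara indices inside the time dual torus). [cite: Salmhofer1999, §4.2.4 (4.63)] -/
theorem val_natCast_matsubaraIdx_of_le [NeZero N] (hN : 2 * M ≤ N) (i : MatsubaraIdx M) :
    (((i : ℕ) : ZMod N)).val = (i : ℕ) := by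
  rw [ZMod.val_natCast, Nat.mod_eq_of_lt (lt_of_lt_of_le i.isLt hN)]

variable (L M N) in
/-- **The zero-padded symbol on the product torus**: `G_σ(q₀, q⃗) = (βL²)⁻² p((n, q⃗), σ)` if `q₀ = n mod N` with `n < 2M`, and `0`
otherwise (BGM 2006, §2.1 footnote ¹: the propagator is a finite Fourier sum). [cite: BenfattoGiulianiMastropietro2006, §2.1 (2.3)] -/
def gridSymbol (β : ℝ) (p : FreqMomentum L M × Fin 2 → ℂ) (σ : Fin 2) (q₀ : TorusSite 1 N) (qv : TorusSite 2 L) : ℂ :=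
  if h : (q₀ 0).val < 2 * M then ((1 / (β * (L : ℝ) ^ 2) : ℝ) : ℂ) ^ 2 * p ((⟨(q₀ 0).val, h⟩, qv), σ) else 0

/-- **Momentum sums are product-torus sums of the padded function**: for `2M ≤ N`,
`Σ_{(i,k⃗)} f(i, k⃗) = Σ_{q₀} Σ_{q⃗} [val q₀ < 2M] f(⟨val q₀⟩, q⃗)` (BGM 2006, §2.1 footnote ¹: the finite Fourier sums at finite `(β, L)`).
[cite: BenfattoGiulianiMastropietro2006, §2.1 (2.3)] -/
theorem sum_freqMomentum_eq_sum_gridTorus [NeZero L] [NeZero N] (hN : 2 * M ≤ N) {E : Type*} [AddCommMonoid E]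
    (f : FreqMomentum L M → E) :
    ∑ k : FreqMomentum L M, f k =
      ∑ q₀ : TorusSite 1 N, ∑ qv : TorusSite 2 L, if h : (q₀ 0).val < 2 * M then f (⟨(q₀ 0).val, h⟩, qv) else 0 := by
  classical
  rw [Fintype.sum_prod_type, Finset.sum_comm]
  rw [Finset.sum_comm]
  -- the time part: `Σ_i g i = Σ_{q₀} [val < 2M] g ⟨val⟩`
  have key : ∀ g : MatsubaraIdx M → E,
      ∑ i : MatsubaraIdx M, g i = ∑ q₀ : TorusSite 1 N, if h : (q₀ 0).val < 2 * M then g ⟨(q₀ 0).val, h⟩ else 0 := by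
    intro g
    rw [← Finset.sum_filter_add_sum_filter_not univ (fun q₀ : TorusSite 1 N => (q₀ 0).val < 2 * M)]
    rw [Finset.sum_eq_zero (s := univ.filter fun q₀ : TorusSite 1 N => ¬(q₀ 0).val < 2 * M) fun q₀ hq => by
      rw [dif_neg (mem_filter.1 hq).2], add_zero]
    refine Finset.sum_bij' (fun i _ => fun _ : Fin 1 => ((i : ℕ) : ZMod N))
      (fun q₀ hq => ⟨(q₀ 0).val, (mem_filter.1 hq).2⟩) (fun i _ => ?_) (fun q₀ hq => mem_univ _) (fun i _ => ?_)
      (fun q₀ hq => ?_) (fun i _ => ?_)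
    · exact mem_filter.2 ⟨mem_univ _, by simp only [val_natCast_matsubaraIdx_of_le hN i]; exact i.isLt⟩
    · exact Fin.ext (val_natCast_matsubaraIdx_of_le hN i)
    · funext l
      rw [Subsingleton.elim l 0]
      simp only [ZMod.natCast_val, ZMod.cast_id', id_eq]
    · have hlt : (((i : ℕ) : ZMod N)).val < 2 * M := by rw [val_natCast_matsubaraIdx_of_le hN i]; exact i.isLt
      rw [dif_pos hlt]
      congr 1
      exact (Fin.ext (val_natCast_matsubaraIdx_of_le hN i)).symm
  rw [key]
  refine sum_congr rfl fun q₀ _ => ?_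
  split_ifs with h
  · rfl
  · simp

/-! ### The temporal phase on the grid -/

/-- **The fermionic frequencies at the grid times are characters of `ℤ/N`**:
`e^{iω_i(τ_j - τ_{j'})} = χ_{(i mod N)}(j - j') · e^{iπ(1-2M)(j-j')/N}` (`β ≠ 0`; `τ_j = jβ/N`, `ω_i = π(2(i-M)+1)/β`).
[cite: Salmhofer1999, §4.2.4 (4.55)–(4.63)] -/
theorem exp_matsubara_gridPhase_eq [NeZero N] {β : ℝ} (hβ : β ≠ 0) (i : MatsubaraIdx M) (j j' : Fin N) :
    Complex.exp (((matsubaraFreq β M i * (gridTime β N j - gridTime β N j') : ℝ) : ℂ) * I) =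
      torusChar (fun _ : Fin 1 => ((i : ℕ) : ZMod N)) (fun _ : Fin 1 => ((j : ℕ) : ZMod N) - ((j' : ℕ) : ZMod N)) *
        Complex.exp (((π * (1 - 2 * M) * (((j : ℕ) : ℝ) - ((j' : ℕ) : ℝ)) / N : ℝ) : ℂ) * I) := by
  have hN : (N : ℂ) ≠ 0 := by exact_mod_cast NeZero.ne N
  have hβ' : (β : ℂ) ≠ 0 := by exact_mod_cast hβ
  rw [torusChar, Fin.prod_univ_one]
  have hcast : ((i : ℕ) : ZMod N) * (((j : ℕ) : ZMod N) - ((j' : ℕ) : ZMod N)) =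
      ((((i : ℕ) : ℤ) * (((j : ℕ) : ℤ) - ((j' : ℕ) : ℤ)) : ℤ) : ZMod N) := by push_cast; ring
  rw [hcast, ZMod.stdAddChar_coe, ← Complex.exp_add]
  congr 1
  simp only [matsubaraFreq, matsubaraInt, gridTime]
  push_cast
  field_simp
  ring

/-! ### The `(+,-)` grid propagator as a character sum -/

section Pullback

variable [NeZero L] [NeZero N]

/-- **The `(+,-)` propagator between grid points is a product-torus character sum**: for `2M ≤ N`, `β ≠ 0`,
`(Sᵀ C S)((j,x⃗,σ,+),(j',x⃗',σ,-)) = e^{iπ(1-2M)(j-j')/N} · Σ_{q₀,q⃗} χ_{q₀}(j-j') χ_{q⃗}(x⃗-x⃗') G_σ(q₀,q⃗)`.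
[cite: BenfattoGiulianiMastropietro2006, §2.1 (2.3)] -/
theorem gridSub_pullback_apply_zero_one_eq_charSum {β : ℝ} (hβ : β ≠ 0) (hN : 2 * M ≤ N)
    (p : FreqMomentum L M × Fin 2 → ℂ) (j j' : Fin N) (x x' : TorusSite 2 L) (σ : Fin 2) :
    ((hubbardGridSub L M β N).transpose * normalCovariance L M p * hubbardGridSub L M β N) (((j, x), σ), 0) (((j', x'), σ), 1) =
      Complex.exp (((π * (1 - 2 * M) * (((j : ℕ) : ℝ) - ((j' : ℕ) : ℝ)) / N : ℝ) : ℂ) * I) *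
        ∑ q₀ : TorusSite 1 N, ∑ qv : TorusSite 2 L,
          torusChar q₀ (fun _ : Fin 1 => ((j : ℕ) : ZMod N) - ((j' : ℕ) : ZMod N)) * torusChar qv (x - x') *
            gridSymbol L M N β p σ q₀ qv := by
  rw [hubbardGridSub, gridSub_pullback_normalCovariance_apply_zero_one, if_pos rfl, Finset.mul_sum,
    sum_freqMomentum_eq_sum_gridTorus hN]
  refine sum_congr rfl fun q₀ _ => ?_
  rw [Finset.mul_sum]
  refine sum_congr rfl fun qv _ => ?_
  by_cases h : (q₀ 0).val < 2 * M
  · rw [dif_pos h, gridSymbol, dif_pos h]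
    dsimp only
    have hphase : Complex.exp (((vertexPhase L M β (⟨(q₀ 0).val, h⟩, qv) x (gridTime β N j) -
        vertexPhase L M β (⟨(q₀ 0).val, h⟩, qv) x' (gridTime β N j') : ℝ) : ℂ) * I) =
        Complex.exp (((matsubaraFreq β M ⟨(q₀ 0).val, h⟩ * (gridTime β N j - gridTime β N j') : ℝ) : ℂ) * I) *
          Complex.exp (((∑ l, latticeMomentum L qv l * (((x l).val : ℝ) - ((x' l).val : ℝ)) : ℝ) : ℂ) * I) := by
      rw [← Complex.exp_add]
      congr 1
      simp only [vertexPhase]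
      push_cast
      simp only [mul_sub, Finset.sum_sub_distrib]
      ring
    have hq₀ : (fun _ : Fin 1 => (((⟨(q₀ 0).val, h⟩ : MatsubaraIdx M) : ℕ) : ZMod N)) = q₀ := by
      funext l
      rw [Subsingleton.elim l 0]
      simp only [ZMod.natCast_val, ZMod.cast_id', id_eq]
    rw [hphase, exp_matsubara_gridPhase_eq hβ, exp_latticeMomentum_phase_eq_torusChar, hq₀]
    ring
  · rw [dif_neg h, gridSymbol, dif_neg h, mul_zero, mul_zero]

/-- Hence `‖(Sᵀ C S)((j,x⃗,σ,+),(j',x⃗',σ,-))‖ = ‖Σ_q χ_q(j-j', x⃗-x⃗') G_σ(q)‖`. [cite: BenfattoGiulianiMastropietro2006, §2.1 (2.3)] -/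
theorem norm_gridSub_pullback_apply_zero_one_eq {β : ℝ} (hβ : β ≠ 0) (hN : 2 * M ≤ N)
    (p : FreqMomentum L M × Fin 2 → ℂ) (j j' : Fin N) (x x' : TorusSite 2 L) (σ : Fin 2) :
    ‖((hubbardGridSub L M β N).transpose * normalCovariance L M p * hubbardGridSub L M β N) (((j, x), σ), 0) (((j', x'), σ), 1)‖ =
      ‖∑ q₀ : TorusSite 1 N, ∑ qv : TorusSite 2 L,
          torusChar q₀ (fun _ : Fin 1 => ((j : ℕ) : ZMod N) - ((j' : ℕ) : ZMod N)) * torusChar qv (x - x') *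
            gridSymbol L M N β p σ q₀ qv‖ := by
  rw [gridSub_pullback_apply_zero_one_eq_charSum hβ hN, norm_mul, Complex.norm_exp_ofReal_mul_I, one_mul]

/-- **Summing over the second grid point is summing over the product torus**:
`Σ_{(j',x⃗')} h(j - j' mod N, x⃗ - x⃗') = Σ_{(a,b)} h(a, b)` (translation invariance of the grid, BGM 2006 §2.1).
[cite: BenfattoGiulianiMastropietro2006, §2.1 (2.3)] -/
theorem sum_gridPoint_eq_sum_prodTorus {E : Type*} [AddCommMonoid E] (h : TorusSite 1 N → TorusSite 2 L → E)
    (j : Fin N) (x : TorusSite 2 L) :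
    ∑ b : GridPoint L N, h (fun _ : Fin 1 => ((j : ℕ) : ZMod N) - ((b.1 : ℕ) : ZMod N)) (x - b.2) =
      ∑ a : TorusSite 1 N, ∑ bv : TorusSite 2 L, h a bv := by
  rw [← Fintype.sum_prod_type']
  refine Fintype.sum_bijective (fun b : GridPoint L N =>
      ((fun _ : Fin 1 => ((j : ℕ) : ZMod N) - ((b.1 : ℕ) : ZMod N)), x - b.2)) ?_ _ _ fun _ => rfl
  refine (Fintype.bijective_iff_injective_and_card _).2 ⟨fun b b' hbb => ?_, ?_⟩
  · have h1 := congr_fun (congr_arg Prod.fst hbb) 0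
    have h2 := congr_arg Prod.snd hbb
    simp only [sub_right_inj] at h1 h2
    refine Prod.ext ?_ h2
    have hv := congr_arg ZMod.val h1
    rwa [ZMod.val_natCast, ZMod.val_natCast, Nat.mod_eq_of_lt b.1.isLt, Nat.mod_eq_of_lt b'.1.isLt, ← Fin.ext_iff] at hv
  · simp only [Fintype.card_prod, Fintype.card_fin, Fintype.card_pi, Fin.prod_const, ZMod.card, pow_one]

/-- **Every row sum of the grid covariance is at most the `ℓ¹` norm of the character sums**: if
`Σ_{(a,b)} ‖Σ_q χ_q(a,b) G_σ(q)‖ ≤ A` for both spins, then `Σ_{Y} ‖(Sᵀ C S)(X, Y)‖ ≤ A` for every grid leg `X`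
(`2M ≤ N`, `β ≠ 0`). [cite: BenfattoGiulianiMastropietro2006, Lemma 2.2 (2.81)] -/
theorem sum_norm_gridSub_pullback_row_le {β : ℝ} (hβ : β ≠ 0) (hN : 2 * M ≤ N) (p : FreqMomentum L M × Fin 2 → ℂ)
    {A : ℝ} (hA : ∀ σ : Fin 2, ∑ a : TorusSite 1 N, ∑ bv : TorusSite 2 L,
      ‖∑ q₀ : TorusSite 1 N, ∑ qv : TorusSite 2 L, torusChar q₀ a * torusChar qv bv * gridSymbol L M N β p σ q₀ qv‖ ≤ A)
    (X : GridLeg (GridPoint L N)) :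
    ∑ Y : GridLeg (GridPoint L N), ‖((hubbardGridSub L M β N).transpose * normalCovariance L M p * hubbardGridSub L M β N) X Y‖ ≤ A := by
  obtain ⟨⟨⟨j, x⟩, σ⟩, c⟩ := X
  set C' := (hubbardGridSub L M β N).transpose * normalCovariance L M p * hubbardGridSub L M β N with hC'
  have hzero : ∀ Y : GridLeg (GridPoint L N), (Y.2 = c ∨ Y.1.2 ≠ σ) → C' (((j, x), σ), c) Y = 0 := by
    rintro Y (hc | hs)
    · exact gridSub_pullback_normalCovariance_apply_of_charge_eq β _ _ p (Y := (((j, x), σ), c)) (Y' := Y) hc.symm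
    · exact gridSub_pullback_normalCovariance_apply_of_spin_ne β _ _ p (Y := (((j, x), σ), c)) (Y' := Y) (Ne.symm hs)
  -- only the legs `((b, σ), 1 - c)` contribute
  have hsum : ∑ Y : GridLeg (GridPoint L N), ‖C' (((j, x), σ), c) Y‖ =
      ∑ b : GridPoint L N, ‖C' (((j, x), σ), c) ((b, σ), if c = 0 then 1 else 0)‖ := by
    rw [Fintype.sum_prod_type, Fintype.sum_prod_type]
    refine sum_congr rfl fun b _ => ?_
    rw [Fintype.sum_eq_single σ fun σ' hσ' => ?_, Fintype.sum_eq_single (if c = 0 then (1 : Fin 2) else 0) fun c' hc' => ?_]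
    · rw [hzero ((b, σ), c') (Or.inl ?_), norm_zero]
      fin_cases c <;> fin_cases c' <;> simp_all
    · exact sum_eq_zero fun c' _ => by rw [hzero ((b, σ'), c') (Or.inr hσ'), norm_zero]
  rw [hsum]
  fin_cases c
  · -- charge `0`: the `(+,-)` orientation
    simp only [Fin.zero_eta, Fin.isValue, if_true]
    calc ∑ b : GridPoint L N, ‖C' (((j, x), σ), 0) ((b, σ), 1)‖
        = ∑ b : GridPoint L N, ‖∑ q₀ : TorusSite 1 N, ∑ qv : TorusSite 2 L,
            torusChar q₀ (fun _ : Fin 1 => ((j : ℕ) : ZMod N) - ((b.1 : ℕ) : ZMod N)) * torusChar qv (x - b.2) *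
              gridSymbol L M N β p σ q₀ qv‖ := sum_congr rfl fun b _ => by
          rw [hC']; exact norm_gridSub_pullback_apply_zero_one_eq hβ hN p j b.1 x b.2 σ
      _ = ∑ a : TorusSite 1 N, ∑ bv : TorusSite 2 L, ‖∑ q₀ : TorusSite 1 N, ∑ qv : TorusSite 2 L,
            torusChar q₀ a * torusChar qv bv * gridSymbol L M N β p σ q₀ qv‖ :=
          sum_gridPoint_eq_sum_prodTorus (fun a bv => ‖∑ q₀ : TorusSite 1 N, ∑ qv : TorusSite 2 L,
            torusChar q₀ a * torusChar qv bv * gridSymbol L M N β p σ q₀ qv‖) j x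
      _ ≤ A := hA σ
  · -- charge `1`: the `(-,+)` orientation, by antisymmetry
    simp only [Fin.mk_one, Fin.isValue, one_ne_zero, if_false]
    calc ∑ b : GridPoint L N, ‖C' (((j, x), σ), 1) ((b, σ), 0)‖
        = ∑ b : GridPoint L N, ‖∑ q₀ : TorusSite 1 N, ∑ qv : TorusSite 2 L,
            torusChar q₀ (fun _ : Fin 1 => ((b.1 : ℕ) : ZMod N) - ((j : ℕ) : ZMod N)) * torusChar qv (b.2 - x) *
              gridSymbol L M N β p σ q₀ qv‖ := sum_congr rfl fun b _ => by
          have h01 := norm_gridSub_pullback_apply_zero_one_eq hβ hN p b.1 j b.2 x σ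
          rw [hubbardGridSub] at h01
          rw [hC', hubbardGridSub, gridSub_pullback_normalCovariance_apply_one_zero, norm_neg]
          exact h01
      _ = ∑ a : TorusSite 1 N, ∑ bv : TorusSite 2 L, ‖∑ q₀ : TorusSite 1 N, ∑ qv : TorusSite 2 L,
            torusChar q₀ (-a) * torusChar qv (-bv) * gridSymbol L M N β p σ q₀ qv‖ := by
          rw [← sum_gridPoint_eq_sum_prodTorus (fun a bv => ‖∑ q₀ : TorusSite 1 N, ∑ qv : TorusSite 2 L,
            torusChar q₀ (-a) * torusChar qv (-bv) * gridSymbol L M N β p σ q₀ qv‖) j x]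
          refine sum_congr rfl fun b _ => ?_
          rw [show -(fun _ : Fin 1 => ((j : ℕ) : ZMod N) - ((b.1 : ℕ) : ZMod N)) =
              fun _ : Fin 1 => ((b.1 : ℕ) : ZMod N) - ((j : ℕ) : ZMod N) from funext fun _ => by simp [neg_sub], neg_sub]
      _ = ∑ a : TorusSite 1 N, ∑ bv : TorusSite 2 L, ‖∑ q₀ : TorusSite 1 N, ∑ qv : TorusSite 2 L,
            torusChar q₀ a * torusChar qv bv * gridSymbol L M N β p σ q₀ qv‖ := by
          rw [← Fintype.sum_prod_type', ← Fintype.sum_prod_type']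
          exact Fintype.sum_equiv (Equiv.neg _) _ _ fun ab => by simp
      _ ≤ A := hA σ

/-- **Every column sum is at most the same constant** (the pulled-back covariance is antisymmetric).
[cite: BenfattoGiulianiMastropietro2006, Lemma 2.2 (2.81)] -/
theorem sum_norm_gridSub_pullback_col_le {β : ℝ} (hβ : β ≠ 0) (hN : 2 * M ≤ N) (p : FreqMomentum L M × Fin 2 → ℂ)
    {A : ℝ} (hA : ∀ σ : Fin 2, ∑ a : TorusSite 1 N, ∑ bv : TorusSite 2 L,
      ‖∑ q₀ : TorusSite 1 N, ∑ qv : TorusSite 2 L, torusChar q₀ a * torusChar qv bv * gridSymbol L M N β p σ q₀ qv‖ ≤ A)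
    (Y : GridLeg (GridPoint L N)) :
    ∑ X : GridLeg (GridPoint L N), ‖((hubbardGridSub L M β N).transpose * normalCovariance L M p * hubbardGridSub L M β N) X Y‖ ≤ A := by
  refine le_of_eq_of_le (sum_congr rfl fun X _ => ?_) (sum_norm_gridSub_pullback_row_le hβ hN p hA Y)
  have h := congrFun (congrFun (gridSub_pullback_normalCovariance_transpose β (fun q : GridPoint L N => q.2)
    (fun q => gridTime β N q.1) p) Y) X
  rw [Matrix.transpose_apply, Matrix.neg_apply] at h
  rw [hubbardGridSub, h, norm_neg]

end Pullback

end Literature.MathematicalPhysics.QuantumLattice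

end
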